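import Summits.NavierStokesRegularity.FluidComputer.PalasekTowerClayBridge
import Literature.Analysis.FluidPDE.StrainedEddyRelaxationRate
import Literature.Analysis.FluidPDE.RadialEddySwirlSpeedBound
import Literature.Analysis.FluidPDE.StrainedEddySwirlMaximum

/-!
# REGISTER v2.3″ (continued): a RADIAL child core forgets its profile at the rate `λA_k` — the sharp
# Burgers constants apply to every radial seed after a logarithmic relaxation clock

Cell `ns-blowup`, seat `ns-blowup-ecbridge-8` (g7); evidence toward the UPPER half of crux 19250
`HeredityFromTwo` (`stub_window_ceiling` / `WindowCeilingAt`) and its floors, route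
`PalasekTowerBreakdown`, in the MODEL lane. Companion of `PalasekTowerLundgrenChildLaws`,
`…ChildSwirlFloor`, `…ChildSwirlCeiling` (ecbridge-8 g5/g6: ANY cross-section, constants carrying
Mathlib's unevaluated planar Gagliardo–Nirenberg–Sobolev constant `C_GNS`, hence a two-sided pin of
the child's peak vorticity only within `[1/(2ρ), 32π(63/50)²C_GNS] ×` the Burgers peak `ΓλA_k/(4π)`).

WHY THIS FILE: no numeric value is provable for `C_GNS` (it is defined through a chosen basis
equivalence), and the register's speed band is `c₂/c₁ = 5/3` — so the any-profile ceilings cannot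
be compared with the register. For a RADIAL seed the child's vorticity is Majda–Bertozzi's strained
viscous eddy (2.71) — the solution of the LINEAR equation (2.70), an exact Navier–Stokes flow
(`RadialEddy.isClassicalNSSolutionOn_strainedViscousEddyT`) — and the Literature theorem
`RadialEddy.abs_strainedEddyVorticity_sub_burgersVortexKernel_le_of_even` (ecbridge-8 g7: Vázquez's
Gaussian asymptotics of the heat semigroup with explicit constants through (2.71)) says that it stays
within `(λA_k/(4π(1 − e^{−λA_k t})))·(λA_k/(2(e^{λA_k t} − 1)))·∫|y|²|ω₀|` of the RELAXING BURGERS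
VORTEX `Γ·Φ_t`, `Φ_t(x) = (λA_k/(4π(1 − e^{−λA_k t})))e^{−λA_k|x|²/(4(1 − e^{−λA_k t}))}` (the
Burgers vortex with `ν = 1` replaced by `1 − e^{−λA_k t}`), uniformly in `x`. In register units
(`ν = 1`, host strain `c = λA_k`, MODEL identification «child core = radial cross-section carried by
the host strain», seed profile `ω₀` with circulation `Γ = ∫ω₀`, mass `N₁ = ∫|ω₀|`, second moment
`N₂ = ∫|y|²|ω₀|`):

* `palasekTowerBreakdown_radialChild_sub_burgers_le` — the deviation bound above (rate `λA_k`: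
  relative to the sharp peak scale `N₁λA_k/(4π(1 − e^{−λA_k t}))` it is `(N₂/N₁)λA_k/(2(e^{λA_k t} − 1))`);
* `palasekTowerBreakdown_radialChild_relaxation_clock` — THE RELAXATION CLOCK: for `ε > 0`, once
  `λA_k t ≥ log(1 + λA_k N₂/(2εN₁))` the child is within `ε·N₁λA_k/(4π(1 − e^{−λA_k t}))` of
  `Γ·Φ_t` everywhere; for a co-signed seed `N₂/N₁ = 4 s_eff(0)` (the effective core parameter of
  `PalasekTowerLundgrenChildLaws`), so the clock reads `log(1 + 2 s_eff(0)λA_k/ε)` — the same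
  logarithmic clock as the N-2′ compaction budget `log((s_eff(0)λA_k − 1)/(ρ − 1))`
  (`palasekTowerBreakdown_compaction_budget_iff_anyProfile`), with `ε` in the rôle of `2(ρ − 1)`;
* `palasekTowerBreakdown_radialChild_peak_pinned` — consequence for a CO-SIGNED radial seed
  (`ω₀ ≥ 0`, `Γ > 0`): after the clock the child's axial vorticity is `≤ (1 + ε)·ΓλA_k/(4π(1 − e^{−λA_k t}))`
  EVERYWHERE and `≥ (1 − ε)·ΓλA_k/(4π(1 − e^{−λA_k t}))` ON THE AXIS — the peak is pinned two-sidedly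
  at the relaxing Burgers peak within the factor `1 ± ε` (any-profile lane: `[1/(2ρ), 32π(63/50)²C_GNS]`);
* `palasekTowerBreakdown_relaxingBurgersPeak_band` — and the relaxing peak itself is within
  `[1, (63/50)²] ×` the Burgers peak `ΓλA_k/(4π)` once `λA_k t ≥ 1`.
* (v2) `palasekTowerBreakdown_radialChild_swirl_le` — THE SWIRL-SPEED CEILING OF A RADIAL CHILD
  WITH AN EXPLICIT CONSTANT: `|v^θ(r, t)| ≤ (N₁/(4π))·(λA_k/(1 − e^{−λA_k t}))^{1/2}` at every time
  `t > 0` and radius (`Literature …RadialEddySwirlSpeedBound`, ecbridge-8 g7: geometric mean of the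
  sharp peak bound and the `L¹` contraction) — g6's any-profile ceiling `K·Γ(λA_k/(1 − e^{−λA_k t}))^{1/2}`
  with `K(C_GNS)` replaced by `1/(4π) ≈ 0.0796` (the Burgers vortex's own maximal swirl is
  `0.0508·Γ(λA_k)^{1/2}`; ratio `1.57 < c₂/c₁ = 5/3`); `…_swirl_le_after_one_strain_time`:
  `≤ (63/50)(N₁/4π)(λA_k)^{1/2}` once `λA_k t ≥ 1`;
* (v2) `palasekTowerBreakdown_radialChild_swirlProfile_sub_burgers_le` — the swirl PROFILE
  `q(t, σ)` (`v^θ = rq(t, r²)`) is within half the vorticity deviation of the relaxing Burgers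
  swirl `(Γ/2πr)(1 − e^{−λA_k r²/4(1 − e^{−λA_k t})})`, so after the relaxation clock the child's
  swirl converges to the Burgers swirl (max `0.0508·Γ(λA_k)^{1/2}` at `r = 2.24δ`) on every bounded
  core region.
* (v3) `palasekTowerBreakdown_radialChild_maxSwirl_floor` / `…_maxSwirl_ceiling` — THE BURGERS
  NUMBER OF ANY RADIAL SEED: after the relaxation clock `λA_k t ≥ log(1 + λA_kN₂/(2εN₁))` the
  child's maximal swirl `S(t) = sup_r|v^θ(r, t)|` is certified two-sidedly at the Burgers scale
  `Γ(λA_k/ν_t)^{1/2}`, `ν_t = 1 − e^{−λA_k t}`: FLOOR `S(t) ≥ v^θ(2δ_t, t) ≥ ((1 − e^{−1})Γ − εN₁)/(4π)·(λA_k/ν_t)^{1/2}`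
  (`≥ (0.632Γ − εN₁)/(4π)·…`), CEILING `S(t) ≤ max(|Γ|/(4√2π) + mεN₁/(8π), N₁/(2πm))·(λA_k/ν_t)^{1/2}`
  for every splitting parameter `m > 0` (`Literature …StrainedEddySwirlMaximum`, ecbridge-8 g7).
  Co-signed seed, `m = 8`, `ε = 1/50`: `S(t)/[Γ(λA_k/ν_t)^{1/2}] ∈ [0.0487, 0.0627]` (ratio `1.29`,
  Burgers' value `0.0508`) — a certified speed band NARROWER than the register's `c₂/c₁ = 5/3` for
  EVERY radial seed profile, where the any-profile lane certifies only `[0.0398ρ^{−1/2}, (63/50)K(C_GNS)]`.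

Reading (numbers, not adjectives): a window lasts `A_k(τ_{k+1} − τ_k) ≈ 61.7–75` strain times
(LEAD-READING-19250-v3 col. 11), i.e. `λ·(61.7–75)` child strain times; the relaxation clock to
`ε = 1/10` from a seed with `s_eff(0)λA_k = 10³` (a thousand Burgers areas) is `log(1 + 2·10⁴) ≈ 9.9`
strain times, to `ε = 1/100` it is `≈ 12.2`: thereafter the SHARP Burgers readings of
`PalasekTowerBurgersNumber` (band `C√λ ∈ [14.1, 23.5]·…`, width exactly `c₂/c₁ = 5/3`) apply to ANY
radial seed profile up to `1 ± ε`, not only to Gaussian seeds.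

WHAT THIS IS NOT: not NS about any registered flow — (2.71) is an exact INFINITE-ENERGY flow
(unbounded strain part), no registered stage; nothing is asserted about `WindowCeilingAt`,
`AprioriCeiling`, the floors or any crux; the identification «child core = radial strained eddy» is a
MODEL step; NON-radial seeds evolve by the nonlinear planar problem (Lundgren), whose convergence to
the Burgers vortex (Gallay–Wayne 2005) is not typed.

References: A. J. Majda, A. L. Bertozzi, *Vorticity and Incompressible Flow*, CUP 2002, §2.3.3
Example 2.9 (2.70)–(2.73) [cite: MajdaBertozziCUP2002, §2.3.3 Example 2.9 eqs. (2.71)–(2.72)];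
J. L. Vázquez, arXiv:1706.10034, Thms. 4.1, 5.1 [cite: Vazquez2017, Theorem 5.1]; S. Palasek,
arXiv:2605.13827, §3 (3.2) [cite: Palasek2026ElementaryModel, §3 (3.2)].
-/

namespace Summit.NavierStokesRegularity.FluidComputer.PalasekTowerClayBridge

open Real Set MeasureTheory
open Literature.Analysis.FluidPDE Literature.Analysis.FluidPDE.RadialEddy

variable {ω₀ : EuclideanSpace ℝ (Fin 2) → ℝ}

/-- **THE RADIAL CHILD RELAXES TO THE BURGERS VORTEX AT THE RATE `λA_k`** (`ν = 1`, host strain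
`c = λA_k`): for an even (in particular radial) seed cross-section `ω₀ ∈ L¹` with finite second
moment, at every time `t > 0` of the run-up and every point `x` of the cross-section,
`|ω(t, x) − Γ·Φ_t(x)| ≤ (λA_k/(4π(1 − e^{−λA_k t})))·(λA_k/(2(e^{λA_k t} − 1)))·∫|y|²|ω₀(y)|dy`,
`Φ_t = burgersVortexKernel (λA_k) 1 · (e^{−λA_k t/2}) 0` the relaxing Burgers vortex of unit
circulation (`RadialEddy.burgersVortexKernel_zero_eq`), `Γ = ∫ω₀`
(`RadialEddy.abs_strainedEddyVorticity_sub_burgersVortexKernel_le_of_even` at `ν = 1`). -/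
theorem palasekTowerBreakdown_radialChild_sub_burgers_le (R : TowerRates) (k : ℕ) {l : ℝ}
    (hl : 0 < l) (hω₀ : Integrable ω₀) (h2 : Integrable fun y => ‖y‖ ^ 2 * |ω₀ y|)
    (heven : ∀ y, ω₀ (-y) = ω₀ y) {t : ℝ} (ht : 0 < t) (x : EuclideanSpace ℝ (Fin 2)) :
    |strainedEddyVorticity (l * R.A k) 1 ω₀ t x -
        burgersVortexKernel (l * R.A k) 1 x (exp (-(l * R.A k / 2) * t)) 0 * ∫ y, ω₀ y| ≤
      l * R.A k / (4 * π * (1 - exp (-(l * R.A k * t)))) *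
        (l * R.A k / (2 * (exp (l * R.A k * t) - 1))) * ∫ y, ‖y‖ ^ 2 * |ω₀ y| := by
  have hγ : 0 < l * R.A k := mul_pos hl (R.A_pos k)
  have h := abs_strainedEddyVorticity_sub_burgersVortexKernel_le_of_even hγ one_pos hω₀ h2 heven ht x
  simpa only [one_mul] using h

/-- **THE RELAXATION CLOCK OF A RADIAL CHILD** (`ν = 1`, host strain `λA_k`; `N₁ = ∫|ω₀| > 0`,
`N₂ = ∫|y|²|ω₀|`): for every tolerance `ε > 0`, once the run-up has delivered
`λA_k t ≥ log(1 + λA_k N₂/(2εN₁))` host strain-times, the child is within `ε` times the sharp peak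
scale `N₁λA_k/(4π(1 − e^{−λA_k t}))` of the relaxing Burgers vortex `Γ·Φ_t`, at EVERY point. For a
co-signed seed `N₂/N₁ = 4s_eff(0)` and the clock is `log(1 + 2s_eff(0)λA_k/ε)` — cf. the N-2′
compaction budget `log((s_eff(0)λA_k − 1)/(ρ − 1))`. -/
theorem palasekTowerBreakdown_radialChild_relaxation_clock (R : TowerRates) (k : ℕ) {l : ℝ}
    (hl : 0 < l) (hω₀ : Integrable ω₀) (h2 : Integrable fun y => ‖y‖ ^ 2 * |ω₀ y|)
    (heven : ∀ y, ω₀ (-y) = ω₀ y) (hN : 0 < ∫ y, |ω₀ y|) {ε : ℝ} (hε : 0 < ε) {t : ℝ} (ht : 0 < t)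
    (hclock : Real.log (1 + l * R.A k * (∫ y, ‖y‖ ^ 2 * |ω₀ y|) / (2 * ε * ∫ y, |ω₀ y|)) ≤
      l * R.A k * t)
    (x : EuclideanSpace ℝ (Fin 2)) :
    |strainedEddyVorticity (l * R.A k) 1 ω₀ t x -
        burgersVortexKernel (l * R.A k) 1 x (exp (-(l * R.A k / 2) * t)) 0 * ∫ y, ω₀ y| ≤
      ε * (l * R.A k / (4 * π * (1 - exp (-(l * R.A k * t)))) * ∫ y, |ω₀ y|) := by
  have hγ : 0 < l * R.A k := mul_pos hl (R.A_pos k)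
  have hclock' : Real.log (1 + l * R.A k * (∫ y, ‖y‖ ^ 2 * |ω₀ y|) /
      (2 * 1 * ε * ∫ y, |ω₀ y|)) ≤ l * R.A k * t := by simpa only [mul_one] using hclock
  have h := abs_strainedEddyVorticity_sub_burgersVortexKernel_le_of_log_le hγ one_pos hω₀ h2 heven
    hN hε ht hclock' x
  simpa only [one_mul] using h

/-- The relaxing Burgers vortex of unit circulation is bounded by its value on the axis,
`0 ≤ Φ_t(x) ≤ Φ_t(0) = c/(4π(1 − e^{−ct}))` (`ν = 1`, `c, t > 0`). -/
theorem burgersVortexKernel_zero_le_axis {c t : ℝ} (hc : 0 < c) (ht : 0 < t)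
    (x : EuclideanSpace ℝ (Fin 2)) :
    0 ≤ burgersVortexKernel c 1 x (exp (-(c / 2) * t)) 0 ∧
      burgersVortexKernel c 1 x (exp (-(c / 2) * t)) 0 ≤ c / (4 * π * (1 - exp (-(c * t)))) ∧
      burgersVortexKernel c 1 0 (exp (-(c / 2) * t)) 0 = c / (4 * π * (1 - exp (-(c * t)))) := by
  have hq : 0 < 1 - exp (-(c * t)) := by
    have : exp (-(c * t)) < 1 := exp_lt_one_iff.2 (by nlinarith [mul_pos hc ht])
    linarith
  have hP : 0 < c / (4 * π * (1 - exp (-(c * t)))) := by positivity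
  rw [burgersVortexKernel_zero_eq, burgersVortexKernel_zero_eq, one_mul, norm_zero]
  refine ⟨by positivity, ?_, ?_⟩
  · refine mul_le_of_le_one_right hP.le ?_
    rw [exp_le_one_iff, neg_nonpos]
    positivity
  · simp

/-- **THE PEAK OF A CO-SIGNED RADIAL CHILD IS PINNED AT THE RELAXING BURGERS PEAK WITHIN `1 ± ε`**
(`ν = 1`, host strain `λA_k`): for a co-signed even seed (`ω₀ ≥ 0`, in particular a co-signed radial
one) with `Γ = ∫ω₀ > 0` and finite second moment `N₂`, and `ε > 0`, once
`λA_k t ≥ log(1 + λA_k N₂/(2εΓ))`: the child's axial vorticity is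
`≤ (1 + ε)·ΓλA_k/(4π(1 − e^{−λA_k t}))` at EVERY point and `≥ (1 − ε)·ΓλA_k/(4π(1 − e^{−λA_k t}))`
ON THE AXIS. (Any-profile lane, `PalasekTowerLundgrenChildLaws` / `…ChildSwirlCeiling`: peak within
`[ΓλA_k/(8πρ), 8(63/50)²C_GNS ΓλA_k]`, `C_GNS` not numerically known.) -/
theorem palasekTowerBreakdown_radialChild_peak_pinned (R : TowerRates) (k : ℕ) {l : ℝ}
    (hl : 0 < l) (hω₀ : Integrable ω₀) (h2 : Integrable fun y => ‖y‖ ^ 2 * |ω₀ y|)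
    (heven : ∀ y, ω₀ (-y) = ω₀ y) (hnn : ∀ y, 0 ≤ ω₀ y) (hΓ : 0 < ∫ y, ω₀ y) {ε : ℝ} (hε : 0 < ε)
    {t : ℝ} (ht : 0 < t)
    (hclock : Real.log (1 + l * R.A k * (∫ y, ‖y‖ ^ 2 * |ω₀ y|) / (2 * ε * ∫ y, ω₀ y)) ≤
      l * R.A k * t) :
    (∀ x : EuclideanSpace ℝ (Fin 2), strainedEddyVorticity (l * R.A k) 1 ω₀ t x ≤
        (1 + ε) * ((∫ y, ω₀ y) * (l * R.A k / (4 * π * (1 - exp (-(l * R.A k * t))))))) ∧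
      (1 - ε) * ((∫ y, ω₀ y) * (l * R.A k / (4 * π * (1 - exp (-(l * R.A k * t)))))) ≤
        strainedEddyVorticity (l * R.A k) 1 ω₀ t 0 := by
  have hγ : 0 < l * R.A k := mul_pos hl (R.A_pos k)
  -- co-signed: `N₁ = Γ`
  have hN1 : (∫ y, |ω₀ y|) = ∫ y, ω₀ y :=
    integral_congr_ae (Filter.Eventually.of_forall fun y => abs_of_nonneg (hnn y))
  have hN : 0 < ∫ y, |ω₀ y| := by rw [hN1]; exact hΓ
  have hclock' : Real.log (1 + l * R.A k * (∫ y, ‖y‖ ^ 2 * |ω₀ y|) / (2 * ε * ∫ y, |ω₀ y|)) ≤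
      l * R.A k * t := by rw [hN1]; exact hclock
  set Γ : ℝ := ∫ y, ω₀ y with hΓdef
  set P : ℝ := l * R.A k / (4 * π * (1 - exp (-(l * R.A k * t)))) with hPdef
  have hdev : ∀ x, |strainedEddyVorticity (l * R.A k) 1 ω₀ t x -
      burgersVortexKernel (l * R.A k) 1 x (exp (-(l * R.A k / 2) * t)) 0 * Γ| ≤ ε * (P * Γ) := by
    intro x
    have h := palasekTowerBreakdown_radialChild_relaxation_clock R k hl hω₀ h2 heven hN hε ht hclock' x
    rwa [hN1] at h
  constructor
  · intro x
    obtain ⟨-, hle, -⟩ := burgersVortexKernel_zero_le_axis hγ ht x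
    have h1 := (abs_le.1 (hdev x)).2
    have h2' : burgersVortexKernel (l * R.A k) 1 x (exp (-(l * R.A k / 2) * t)) 0 * Γ ≤ P * Γ :=
      mul_le_mul_of_nonneg_right hle hΓ.le
    nlinarith
  · obtain ⟨-, -, h0⟩ := burgersVortexKernel_zero_le_axis hγ ht (0 : EuclideanSpace ℝ (Fin 2))
    have h1 := (abs_le.1 (hdev 0)).1
    rw [h0] at h1
    nlinarith

/-- `(1 − e^{−x})⁻¹ ≤ (63/50)²` for `x ≥ 1` (`e^{−1} < 0.3678794412`). [folklore] -/
private theorem inv_one_sub_exp_neg_le' {x : ℝ} (hx : 1 ≤ x) :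
    (1 - exp (-x))⁻¹ ≤ (63 / 50) ^ 2 := by
  have h1 : exp (-x) ≤ exp (-1) := exp_le_exp.2 (by linarith)
  have h2 : exp (-1) < 0.3678794412 := exp_neg_one_lt_d9
  have hpos : 0 < 1 - exp (-x) := by linarith
  rw [inv_le_comm₀ hpos (by norm_num)]
  norm_num at h2 ⊢
  linarith

/-- **THE RELAXING BURGERS PEAK IS THE BURGERS PEAK UP TO `(63/50)²` AFTER ONE STRAIN TIME**
(`ν = 1`, host strain `λA_k`): for `λA_k t ≥ 1`,
`ΓλA_k/(4π) ≤ Γ·Φ_t(0) = ΓλA_k/(4π(1 − e^{−λA_k t})) ≤ (63/50)²·ΓλA_k/(4π)` (`Γ ≥ 0`) — with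
`_radialChild_peak_pinned`, the peak of a co-signed radial child sits in
`[(1 − ε), (63/50)²(1 + ε)] × ΓλA_k/(4π)` (the Burgers peak) after `max(1, clock)` strain times. -/
theorem palasekTowerBreakdown_relaxingBurgersPeak_band (R : TowerRates) (k : ℕ) {l : ℝ} (hl : 0 < l)
    {Γ : ℝ} (hΓ : 0 ≤ Γ) {t : ℝ} (hstrain : 1 ≤ l * R.A k * t) :
    Γ * (l * R.A k / (4 * π)) ≤ Γ * (l * R.A k / (4 * π * (1 - exp (-(l * R.A k * t))))) ∧
      Γ * (l * R.A k / (4 * π * (1 - exp (-(l * R.A k * t))))) ≤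
        (63 / 50) ^ 2 * (Γ * (l * R.A k / (4 * π))) := by
  have hγ : 0 < l * R.A k := mul_pos hl (R.A_pos k)
  have he1 : exp (-(l * R.A k * t)) < 1 := exp_lt_one_iff.2 (by linarith)
  have he0 : 0 < exp (-(l * R.A k * t)) := exp_pos _
  have hq : 0 < 1 - exp (-(l * R.A k * t)) := by linarith
  have hq1 : 1 - exp (-(l * R.A k * t)) ≤ 1 := by linarith
  have hinv := inv_one_sub_exp_neg_le' hstrain
  have hsplit : l * R.A k / (4 * π * (1 - exp (-(l * R.A k * t)))) =
      l * R.A k / (4 * π) * (1 - exp (-(l * R.A k * t)))⁻¹ := by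
    rw [div_mul_eq_div_div, div_eq_mul_inv (l * R.A k / (4 * π))]
  rw [hsplit]
  have hB : 0 ≤ Γ * (l * R.A k / (4 * π)) := by positivity
  constructor
  · have h1 : 1 ≤ (1 - exp (-(l * R.A k * t)))⁻¹ := one_le_inv_iff₀.2 ⟨hq, hq1⟩
    calc Γ * (l * R.A k / (4 * π)) = Γ * (l * R.A k / (4 * π)) * 1 := (mul_one _).symm
      _ ≤ Γ * (l * R.A k / (4 * π)) * (1 - exp (-(l * R.A k * t)))⁻¹ :=
          mul_le_mul_of_nonneg_left h1 hB
      _ = Γ * (l * R.A k / (4 * π) * (1 - exp (-(l * R.A k * t)))⁻¹) := by ring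
  · calc Γ * (l * R.A k / (4 * π) * (1 - exp (-(l * R.A k * t)))⁻¹)
        = Γ * (l * R.A k / (4 * π)) * (1 - exp (-(l * R.A k * t)))⁻¹ := by ring
      _ ≤ Γ * (l * R.A k / (4 * π)) * (63 / 50) ^ 2 := mul_le_mul_of_nonneg_left hinv hB
      _ = (63 / 50) ^ 2 * (Γ * (l * R.A k / (4 * π))) := by ring

/-! ### (v2) The swirl speed of a radial child: explicit constant `1/(4π)` -/

/-- **THE SWIRL-SPEED CEILING OF A RADIAL CHILD, EXPLICIT CONSTANT** (`ν = 1`, host strain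
`c = λA_k`): for a RADIAL seed `ω₀ ∈ L¹` with mass `N₁ = ∫|ω₀|`, at every time `t > 0` of the
run-up and every radius `r ≥ 0`, the child's swirl speed `v^θ(r, t) = rq(t, r²)` obeys
`|v^θ(r, t)| ≤ (N₁/(4π))·(λA_k/(1 − e^{−λA_k t}))^{1/2}` (`RadialEddy.abs_swirl_strainedEddy_le`
at `ν = 1`) — compare g6's any-profile `K·Γ(λA_k/(1 − e^{−λA_k t}))^{1/2}` with
`K = (2π)⁻¹((3π)^{3/4}((128/3)C_GNS³)^{1/4} + 1)` not numerically known. -/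
theorem palasekTowerBreakdown_radialChild_swirl_le (R : TowerRates) (k : ℕ) {l : ℝ} (hl : 0 < l)
    (hω₀ : Integrable ω₀)
    (hrad : ∀ (U : EuclideanSpace ℝ (Fin 2) ≃ₗᵢ[ℝ] EuclideanSpace ℝ (Fin 2))
      (y : EuclideanSpace ℝ (Fin 2)), ω₀ (U y) = ω₀ y)
    {t : ℝ} (ht : 0 < t) {r : ℝ} (hr : 0 ≤ r) :
    |r * vorticityToSwirl (rayProfile (strainedEddyVorticity (l * R.A k) 1 ω₀ t)) (r ^ 2)| ≤
      (∫ y, |ω₀ y|) / (4 * π) * Real.sqrt (l * R.A k / (1 - exp (-(l * R.A k * t)))) := by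
  have hγ : 0 < l * R.A k := mul_pos hl (R.A_pos k)
  have h := abs_swirl_strainedEddy_le hγ one_pos hω₀ hrad ht hr
  simpa only [one_mul] using h

/-- `(1 − e^{−x})⁻¹ ≤ (63/50)²` hence `√((1 − e^{−x})⁻¹) ≤ 63/50` for `x ≥ 1`. [folklore] -/
private theorem sqrt_inv_one_sub_exp_neg_le {x : ℝ} (hx : 1 ≤ x) :
    Real.sqrt ((1 - exp (-x))⁻¹) ≤ 63 / 50 := by
  rw [Real.sqrt_le_left (by norm_num)]
  exact inv_one_sub_exp_neg_le' hx

/-- **AFTER ONE STRAIN TIME THE RADIAL CHILD'S SWIRL IS `≤ (63/50)(N₁/4π)(λA_k)^{1/2}`**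
(`ν = 1`; `λA_k t ≥ 1`): the Burgers swirl scale `Γ(λA_k)^{1/2}` with the constant
`(63/50)/(4π) ≈ 0.100` for every radial seed profile (Burgers' own maximum `0.0508`), to be read
against the any-profile floor `(8π)⁻¹ρ^{−1/2} ≈ 0.0398ρ^{−1/2}` after the N-2′ budget
(`_childSwirl_floor_of_budget_anyProfile`) and the register's speed band `c₂/c₁ = 5/3`. -/
theorem palasekTowerBreakdown_radialChild_swirl_le_after_one_strain_time (R : TowerRates) (k : ℕ)
    {l : ℝ} (hl : 0 < l) (hω₀ : Integrable ω₀)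
    (hrad : ∀ (U : EuclideanSpace ℝ (Fin 2) ≃ₗᵢ[ℝ] EuclideanSpace ℝ (Fin 2))
      (y : EuclideanSpace ℝ (Fin 2)), ω₀ (U y) = ω₀ y)
    {t : ℝ} (hstrain : 1 ≤ l * R.A k * t) {r : ℝ} (hr : 0 ≤ r) :
    |r * vorticityToSwirl (rayProfile (strainedEddyVorticity (l * R.A k) 1 ω₀ t)) (r ^ 2)| ≤
      63 / 50 * ((∫ y, |ω₀ y|) / (4 * π)) * Real.sqrt (l * R.A k) := by
  have hγ : 0 < l * R.A k := mul_pos hl (R.A_pos k)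
  have ht : 0 < t := by
    by_contra hle
    have : l * R.A k * t ≤ 0 := mul_nonpos_of_nonneg_of_nonpos hγ.le (not_lt.1 hle)
    linarith
  have hN : 0 ≤ (∫ y, |ω₀ y|) / (4 * π) := by
    have : 0 ≤ ∫ y, |ω₀ y| := integral_nonneg fun y => abs_nonneg _
    positivity
  have hq : 0 < 1 - exp (-(l * R.A k * t)) := by
    have : exp (-(l * R.A k * t)) < 1 := exp_lt_one_iff.2 (by linarith)
    linarith
  refine (palasekTowerBreakdown_radialChild_swirl_le R k hl hω₀ hrad ht hr).trans ?_
  have hs : Real.sqrt (l * R.A k / (1 - exp (-(l * R.A k * t)))) ≤ Real.sqrt (l * R.A k) * (63 / 50) := by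
    rw [div_eq_mul_inv, Real.sqrt_mul hγ.le]
    exact mul_le_mul_of_nonneg_left (sqrt_inv_one_sub_exp_neg_le hstrain) (Real.sqrt_nonneg _)
  calc (∫ y, |ω₀ y|) / (4 * π) * Real.sqrt (l * R.A k / (1 - exp (-(l * R.A k * t))))
      ≤ (∫ y, |ω₀ y|) / (4 * π) * (Real.sqrt (l * R.A k) * (63 / 50)) :=
        mul_le_mul_of_nonneg_left hs hN
    _ = 63 / 50 * ((∫ y, |ω₀ y|) / (4 * π)) * Real.sqrt (l * R.A k) := by ring

/-- **THE RADIAL CHILD'S SWIRL PROFILE CONVERGES TO THE BURGERS SWIRL** (`ν = 1`, host strain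
`λA_k`): for an even (radial) seed with finite second moment, `t > 0` and `σ = r² ≥ 0`, the swirl
profile `q(t, σ)` of the child (`v^θ = rq(t, r²)`) is within
`½·(λA_k/(4π(1 − e^{−λA_k t})))·(λA_k/(2(e^{λA_k t} − 1)))·N₂` of the relaxing Burgers swirl profile
`burgersProfile (λA_kΓ/(8π(1 − e^{−λA_k t}))) (λA_k/(4(1 − e^{−λA_k t})))`
(`v^θ_B = (Γ/2πr)(1 − e^{−λA_k r²/4(1 − e^{−λA_k t})})`, maximum `→ 0.0508·Γ(λA_k)^{1/2}` at
`r = 2.24δ`) — hence `|v^θ(r, t) − v^θ_B(r, t)| ≤ (r/2)·deviation`, exponentially small after the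
relaxation clock on every bounded core region (`RadialEddy.abs_vorticityToSwirl_strainedEddy_sub_burgersProfile_le_of_even`). -/
theorem palasekTowerBreakdown_radialChild_swirlProfile_sub_burgers_le (R : TowerRates) (k : ℕ)
    {l : ℝ} (hl : 0 < l) (hω₀ : Integrable ω₀) (h2 : Integrable fun y => ‖y‖ ^ 2 * |ω₀ y|)
    (heven : ∀ y, ω₀ (-y) = ω₀ y) {t : ℝ} (ht : 0 < t) {σ : ℝ} (hσ : 0 ≤ σ) :
    |vorticityToSwirl (rayProfile (strainedEddyVorticity (l * R.A k) 1 ω₀ t)) σ -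
        StrainedAzimuthal.burgersProfile
          (l * R.A k * (∫ y, ω₀ y) / (8 * π * (1 - exp (-(l * R.A k * t)))))
          (l * R.A k / (4 * (1 - exp (-(l * R.A k * t))))) σ| ≤
      2⁻¹ * (l * R.A k / (4 * π * (1 - exp (-(l * R.A k * t)))) *
        (l * R.A k / (2 * (exp (l * R.A k * t) - 1))) * ∫ y, ‖y‖ ^ 2 * |ω₀ y|) := by
  have hγ : 0 < l * R.A k := mul_pos hl (R.A_pos k)
  have h := abs_vorticityToSwirl_strainedEddy_sub_burgersProfile_le_of_even hγ one_pos hω₀ h2 heven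
    ht hσ
  simpa only [one_mul] using h

/-! ### (v3) The Burgers number of any radial seed: the maximal swirl after the relaxation clock -/

/-- **THE FLOOR OF THE RADIAL CHILD'S MAXIMAL SWIRL AFTER THE RELAXATION CLOCK** (`ν = 1`, host
strain `c = λA_k`; even seed `ω₀ ∈ L¹`, `Γ = ∫ω₀`, `N₁ = ∫|ω₀| > 0`, `N₂ = ∫|y|²|ω₀|`, `ε > 0`,
`t > 0` with `λA_k t ≥ log(1 + λA_kN₂/(2εN₁))`): at the radius `r₀ = 2(ν_t/λA_k)^{1/2}`,
`ν_t = 1 − e^{−λA_k t}`, the child's swirl speed is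
`≥ ((1 − e^{−1})Γ − εN₁)/(4π)·(λA_k/ν_t)^{1/2}` — so `sup_r|v^θ(r, t)| ≥ (0.632Γ − εN₁)/(4π)·(λA_k/ν_t)^{1/2}`
(`RadialEddy.mul_vorticityToSwirl_strainedEddy_two_core_ge_of_log_le` at `ν = 1`). -/
theorem palasekTowerBreakdown_radialChild_maxSwirl_floor (R : TowerRates) (k : ℕ) {l : ℝ}
    (hl : 0 < l) (hω₀ : Integrable ω₀) (h2 : Integrable fun y => ‖y‖ ^ 2 * |ω₀ y|)
    (heven : ∀ y, ω₀ (-y) = ω₀ y) (hN : 0 < ∫ y, |ω₀ y|) {ε : ℝ} (hε : 0 < ε) {t : ℝ} (ht : 0 < t)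
    (hclock : Real.log (1 + l * R.A k * (∫ y, ‖y‖ ^ 2 * |ω₀ y|) / (2 * ε * ∫ y, |ω₀ y|)) ≤
      l * R.A k * t) :
    ((1 - exp (-1)) * (∫ y, ω₀ y) - ε * ∫ y, |ω₀ y|) / (4 * π) *
        Real.sqrt (l * R.A k / (1 - exp (-(l * R.A k * t)))) ≤
      2 * Real.sqrt ((1 - exp (-(l * R.A k * t))) / (l * R.A k)) *
        vorticityToSwirl (rayProfile (strainedEddyVorticity (l * R.A k) 1 ω₀ t))
          ((2 * Real.sqrt ((1 - exp (-(l * R.A k * t))) / (l * R.A k))) ^ 2) := by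
  have hγ : 0 < l * R.A k := mul_pos hl (R.A_pos k)
  have hclock' : Real.log (1 + l * R.A k * (∫ y, ‖y‖ ^ 2 * |ω₀ y|) /
      (2 * 1 * ε * ∫ y, |ω₀ y|)) ≤ l * R.A k * t := by simpa only [mul_one] using hclock
  have h := mul_vorticityToSwirl_strainedEddy_two_core_ge_of_log_le hγ one_pos hω₀ h2 heven hN hε
    ht hclock'
  simpa only [one_mul] using h

/-- **THE CEILING OF THE RADIAL CHILD'S SWIRL AFTER THE RELAXATION CLOCK** (`ν = 1`, host strain
`c = λA_k`; RADIAL seed, same clock, any splitting parameter `m > 0`): for every radius `r ≥ 0`,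
`|v^θ(r, t)| ≤ max(|Γ|/(4√2π) + mεN₁/(8π), N₁/(2πm))·(λA_k/ν_t)^{1/2}`, `ν_t = 1 − e^{−λA_k t}`
(`RadialEddy.abs_mul_vorticityToSwirl_strainedEddy_le_of_log_le` at `ν = 1`). With the floor:
co-signed seed, `m = 8`, `ε = 1/50` ⇒ `sup_r|v^θ|/[Γ(λA_k/ν_t)^{1/2}] ∈ [0.0487, 0.0627]` —
ratio `1.29 < c₂/c₁ = 5/3`, Burgers' own value `0.0508`, for every radial profile. -/
theorem palasekTowerBreakdown_radialChild_maxSwirl_ceiling (R : TowerRates) (k : ℕ) {l : ℝ}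
    (hl : 0 < l) (hω₀ : Integrable ω₀) (h2 : Integrable fun y => ‖y‖ ^ 2 * |ω₀ y|)
    (hrad : ∀ (U : EuclideanSpace ℝ (Fin 2) ≃ₗᵢ[ℝ] EuclideanSpace ℝ (Fin 2))
      (y : EuclideanSpace ℝ (Fin 2)), ω₀ (U y) = ω₀ y)
    (hN : 0 < ∫ y, |ω₀ y|) {ε : ℝ} (hε : 0 < ε) {t : ℝ} (ht : 0 < t)
    (hclock : Real.log (1 + l * R.A k * (∫ y, ‖y‖ ^ 2 * |ω₀ y|) / (2 * ε * ∫ y, |ω₀ y|)) ≤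
      l * R.A k * t)
    {m : ℝ} (hm : 0 < m) {r : ℝ} (hr : 0 ≤ r) :
    |r * vorticityToSwirl (rayProfile (strainedEddyVorticity (l * R.A k) 1 ω₀ t)) (r ^ 2)| ≤
      max (|∫ y, ω₀ y| / (4 * Real.sqrt 2 * π) + m * ε * (∫ y, |ω₀ y|) / (8 * π))
          ((∫ y, |ω₀ y|) / (2 * π * m)) *
        Real.sqrt (l * R.A k / (1 - exp (-(l * R.A k * t)))) := by
  have hγ : 0 < l * R.A k := mul_pos hl (R.A_pos k)
  have hclock' : Real.log (1 + l * R.A k * (∫ y, ‖y‖ ^ 2 * |ω₀ y|) /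
      (2 * 1 * ε * ∫ y, |ω₀ y|)) ≤ l * R.A k * t := by simpa only [mul_one] using hclock
  have h := abs_mul_vorticityToSwirl_strainedEddy_le_of_log_le hγ one_pos hω₀ h2 hrad hN hε ht
    hclock' hm hr
  simpa only [one_mul] using h

end Summit.NavierStokesRegularity.FluidComputer.PalasekTowerClayBridge
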